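import Literature.MathematicalPhysics.QuantumFieldTheory.Balaban1983to89.B9Thm37CubeCoverCommutators
import Literature.MathematicalPhysics.QuantumFieldTheory.Balaban1983to89.B6Partition118KLevelTorusBinders
import Literature.MathematicalPhysics.QuantumFieldTheory.Balaban1983to89.B9GeoLemma21KLevelV1

/-!
# `Balaban1983to89.B9Thm37CubeCoverCommutatorSizes` — T. Bałaban, *Propagators for lattice gauge theories in a background field*,
# Commun. Math. Phys. **99** (1985) 389–434 [Balaban1985BackgroundPropagators], Sect. C p. 409, (3.88)–(3.89) with [4] p. 230 (2.40) and p. 247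
# («|∂h_□| ≤ O(1)(MLʲη)⁻¹»): THE `G′`-FREE HALF OF (3.89) — POINTWISE SIZES OF THE COEFFICIENTS OF PRINT'S COMMUTATOR `K(h)(U)` AT CONTRACTION-PAIR
# TRANSPORTERS, AND THE `O(M⁻¹)` AT THE PARTITION OF RECORD `h_□` (sub-row G-B9-LETTERS, module M5.4-comb, file B; the other half of (3.89) is
# (3.42) for `G′_□` — module M5.2 ∕ M5.4-est — and is NOT here)

statement-level skeleton of published theorems with citation tags; proofs where landed; nothing here is a claim about the Yang–Mills mass gap

PDF held: `paper:balaban1985-cmp99-background-propagators` (journal page = PDF page + 388); p. 409 read as page image `…-p021-x2.png` and text layer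
`p0021.txt`.  [4] = [Balaban1984PropagatorsII], Commun. Math. Phys. **96** (1984) 223–250, p. 230 (2.40)∕(2.44), p. 247.

CITATION HEADER (lean-in-tree rule) — WHAT IS PRINTED.  p. 409: *«Using the inequalities (3.42) for G′_□, we get the bound |(K(h_□)G′_□h_□λ)(x)| ≤
O(M⁻¹)e^{−δ₀(Lʲη)⁻¹|y−y′|}|λ| (3.89) for x ∈ Δ(y), supp λ ⊂ Δ(y′), y, y′ ∈ □ ∈ 𝒟_j. It is exactly the bound (2.44) of [4], rescaled to η-scale.»*
[4] p. 230: *«|(K(h_□)G′(□)h_□λ)(x)| ≤ O(M⁻¹)e^{−δ₀|x−y|}|λ| (2.44)»*; [4] p. 247: *«|∂h_□| ≤ O(1)(MLʲη)⁻¹, |Δh_□| ≤ O(1)(MLʲη)⁻²»*.  The factor `O(M⁻¹)`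
is the product of TWO things: the size of the coefficients of the first-order operator `K(h_□)` (the differences of `h_□` over one lattice step ∕ one
averaging block — THIS FILE) and the bounds (3.42) for `G′_□h_□λ` and `∇_UG′_□h_□λ` (module M5.2; assembled in M5.4-est).

CELL ∕ SUB-ROW.  Cell `lit-balaban` (HOME `run/shared/lean/pub/lit-balaban/`), sub-row G-B9-LETTERS, module **M5.4-comb** file B; seat p38 gen 37
(literature-prover-lit-balaban-p38-g37-0); file A = `…B9Thm37CubeCoverCommutators` (p593034).  SKELETON rows B9.Thm3.7 × B9.Def@408 (cells only).

## WHAT THIS FILE PROVES (kernel-checked, 0 sorry, standard axioms; THEOREMS + one real constant `thetaK`; no `def … : Prop`, no new fact)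
* §1 `norm_R_le_of_pair` — `‖R(u)a‖ ≤ ‖a‖` for a CONTRACTION PAIR `‖u‖ ≤ 1 ∧ ‖u⁻¹‖ ≤ 1` (print's `G ⊂ U(N)`: equality; w1∕p21's formulation).
* §2 ★ `norm_KhY_apply_le` — THE GENERIC POINTWISE SIZE of file A's stencil: for bond variables and averaging transporters that are contraction pairs,
  `‖(K(h)(U)Λ)(z)‖ ≤ Σ_μ (|h(z+e_μ) − h z|·‖Λ(z+e_μ)‖ + |h(z−e_μ) − h z|·‖Λ(z−e_μ)‖) + Σ_w |avgCoeffY(z,w)|·|h z − h w|·‖Λ w‖`, and its sup form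
  `norm_KhY_apply_le_of_bound` (`≤ (Σ_μ … + Σ_w …)·B` when `‖Λ‖ ≤ B` on the stencil).
* §3 THE DIFFERENCES OF THE PARTITION OF RECORD `h_□ = hTY i c` over the stencil (this seat's gen-26 torus binders, READ on def-Y's carrier):
  `abs_hTY_shiftY_sub_le` ∕ `abs_hTY_shiftY_symm_sub_le` — one lattice step costs `≤ C1F∕(8∕5·S_j)`, `S_j = bigSide = M_h·L^{j+1}` (print's
  `|∂h_□| ≤ O(1)(MLʲη)⁻¹`); `abs_hTY_sub_le_of_avgCoeffY_ne_zero` — inside one averaging block (`avgCoeffY(z,w) ≠ 0`) the cost is `≤ sLipT∕(L·M_h)`;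
  `sum_abs_avgCoeffY_le_one` — the total averaging weight at a site is `a_{lev z}·L^{−2·lev z} ≤ 1`.
* §4 ★★ `norm_KhY_hTY_apply_le` — **THE `O(M⁻¹)` OF (3.89) BEFORE `G′_□` ENTERS**: `‖(K(h_□)(U)Λ)(z)‖ ≤ thetaK(d,L)∕(L·M_h) · B` whenever `‖Λ‖ ≤ B` on
  the stencil of `z`, with the EXPLICIT constant `thetaK d ℓ := 2(d+1)·(5∕8)·C1F d ℓ + sLipT d ℓ` (d, L only; print: «O(M⁻¹)», `M = L·M_h`).
* §5 `exists_mem_stencilY_hTY_ne_of_KhY_ne_zero`, `exists_mem_stencilY_blkOf_mem_QT_of_KhY_ne_zero` — OUTPUT LOCALISATION: where `K(h_□)(U)Λ` is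
  non-zero, `h_□` is not constant on the stencil, hence some stencil site has its block in `QT □ ⊂ □̃` (the localisation set `S′_□` of
  `B9Thm37Sum.thm37_entry1`'s `h389 ∕ hcnt′` is the 1-stencil thickening of `QT □`; its overlap count is M5.4-est's, from r03's
  `B6Cover236QbigOverlapV1.card_filter_mem_QbigT_le`).

HONEST SCOPE ∕ DIVERGENCES.  (1) Contraction pairs: for print's `G ⊂ U(N) ⊂ M_N(ℂ)` with the operator norm every `U(b)` is one (equality
`‖R(u)a‖ = ‖a‖`); we assume the pair property as hypotheses on `UboxY i U` and `avgTrY i par U` (no class predicate introduced).  (2) Print's exponent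
in (3.89) and the `e^{−δ₀…}` come from (3.42) for `G′_□`, not from `K(h)`: NOT here.  (3) Lattice units as in all of NODE 00 (`η` absorbed; print's
`(MLʲη)⁻¹` is our `1∕S_j`, and we bound `1∕S_j ≤ 1∕(L·M_h)` uniformly in `j ≥ 0`).  (4) Side conditions `L ≥ 5`, `M_h ≥ 8`, `R ≥ 2L²`, `P′ ≥ 5` are the
member's (`KIdx.hℓ ∕ hM8 ∕ hR2 ∕ hP5`).  Nothing continuum ∕ OS ∕ mass gap ∕ Clay; YM mass gap NOT proved by any of this (Track A conditional rung).
`--supports stmt-QuantumFields-19200`.  Net new unproved facts: 0.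
-/

noncomputable section

namespace Literature.MathematicalPhysics.QuantumFieldTheory.Balaban1983to89.B9Thm37CubeCoverCommutatorSizes

open Node00
open B9Thm37CubeCoverCommutators
open B6KLevelCensusIndexV1 (KIdx)
open B4Reflection242 (boxDom blk)
open B4TorusKernel.MultiPeriod (torusSupNorm translate torusSupNorm_translate torusSupNorm_le_supNorm)
open B6MultiLevelBoxOperator (N0 bigSide bigSide_eq levC aPrinted)
open B6MultiLevelTorusOperator (tshift unitVec tshift_symm_apply tshift_val_eq_translate one_le_of_mem)
open B6Geom246MultiLevelBox (blkOf blkOf_eq_of_blk_i_eq)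
open B6Geom246MultiLevelTorus (bondT torusSupNorm_neg)
open B6Cover236MultiLevelBlocks (cubes)
open B6Partition118KLevelTorus (hT)
open B6Partition118KLevelFineSizes (C1F C1F_nonneg)
open B6Partition118KLevelTorusCentral (QT)
open B6Partition118KLevelTorusBinders (sLipT sLipT_nonneg abs_hT_sub_le_near abs_hT_sub_le_distT)
open B9Eq39Adjoint (R R_def)
open scoped Matrix

variable {𝔸 : Type} [NormedRing 𝔸] [NormedAlgebra ℂ 𝔸] [CompleteSpace 𝔸]

/-! ## §1 Conjugation by a contraction pair does not increase the norm -/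

omit [NormedAlgebra ℂ 𝔸] [CompleteSpace 𝔸] in
/-- `‖R(u)a‖ = ‖u a u⁻¹‖ ≤ ‖a‖` when `‖u‖ ≤ 1` and `‖u⁻¹‖ ≤ 1` (print: `u ∈ G ⊂ U(N)`). [cite: Balaban1985BackgroundPropagators, (3.28) p.395 («R(u)»), p.396 («U has values in G»)] -/
theorem norm_R_le_of_pair (u : 𝔸ˣ) (hu : ‖(u : 𝔸)‖ ≤ 1) (hu' : ‖((u⁻¹ : 𝔸ˣ) : 𝔸)‖ ≤ 1) (a : 𝔸) : ‖R u a‖ ≤ ‖a‖ := by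
  rw [R_def]
  calc ‖(u : 𝔸) * a * ((u⁻¹ : 𝔸ˣ) : 𝔸)‖ ≤ ‖(u : 𝔸) * a‖ * ‖((u⁻¹ : 𝔸ˣ) : 𝔸)‖ := norm_mul_le _ _
    _ ≤ (‖(u : 𝔸)‖ * ‖a‖) * ‖((u⁻¹ : 𝔸ˣ) : 𝔸)‖ := mul_le_mul_of_nonneg_right (norm_mul_le _ _) (norm_nonneg _)
    _ ≤ (1 * ‖a‖) * 1 :=
        mul_le_mul (mul_le_mul_of_nonneg_right hu (norm_nonneg _)) hu' (norm_nonneg _) (by positivity)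
    _ = ‖a‖ := by ring

omit [CompleteSpace 𝔸] in
/-- the norm of a real-scalar multiple: `‖(r : ℂ)•x‖ = |r|·‖x‖`. [cite: Balaban1985BackgroundPropagators, (3.39) p.397, bookkeeping] -/
theorem norm_ofReal_smul (r : ℝ) (x : 𝔸) : ‖((r : ℝ) : ℂ) • x‖ = |r| * ‖x‖ := by
  rw [norm_smul, Complex.norm_real, Real.norm_eq_abs]

/-! ## §2 The generic pointwise size of `K(h)(U)` -/

section Generic

variable {d ℓ : ℕ} {hd : 1 ≤ d + 1} {hL : Odd (ℓ + 1) ∧ 1 < ℓ + 1} {b₀ b₁ : ℝ}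
variable (i : KIdx d ℓ hd hL b₀ b₁)

/-- ★ **THE GENERIC POINTWISE SIZE OF PRINT'S `K(h)`** (file A's stencil `KhY_apply`, term by term): for bond variables `U_μ(w)` and averaging
transporters that are contraction pairs,
`‖(K(h)(U)Λ)(z)‖ ≤ Σ_μ (|h(z+e_μ) − h(z)|·‖Λ(z+e_μ)‖ + |h(z−e_μ) − h(z)|·‖Λ(z−e_μ)‖) + Σ_w |avgCoeffY(z,w)|·|h(z) − h(w)|·‖Λ(w)‖`.
[cite: Balaban1985BackgroundPropagators, (3.88)–(3.89) p.409; Balaban1984PropagatorsII, (2.40) p.230] -/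
theorem norm_KhY_apply_le (par : SiteParY 𝔸 i) (h : SiteY i → ℝ) (U : CfgY 𝔸 i) (Λ : SiteY i → 𝔸) (z : SiteY i)
    (hU : ∀ (μ : Fin (d + 1)) (w : SiteY i), ‖(UboxY i U μ w : 𝔸)‖ ≤ 1 ∧ ‖(((UboxY i U μ w)⁻¹ : 𝔸ˣ) : 𝔸)‖ ≤ 1)
    (hT : ∀ w : SiteY i, ‖(avgTrY i par U z w : 𝔸)‖ ≤ 1 ∧ ‖(((avgTrY i par U z w)⁻¹ : 𝔸ˣ) : 𝔸)‖ ≤ 1) :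
    ‖KhY i par h U Λ z‖
      ≤ (∑ μ : Fin (d + 1),
          (|h (shiftY i μ z) - h z| * ‖Λ (shiftY i μ z)‖ + |h ((shiftY i μ).symm z) - h z| * ‖Λ ((shiftY i μ).symm z)‖))
        + ∑ w, |avgCoeffY i z w| * |h z - h w| * ‖Λ w‖ := by
  rw [KhY_apply]
  refine le_trans (norm_add_le _ _) (add_le_add ?_ ?_)
  · refine le_trans (norm_sum_le _ _) (Finset.sum_le_sum fun μ _ => ?_)
    refine le_trans (norm_add_le _ _) (add_le_add ?_ ?_)
    · rw [norm_ofReal_smul]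
      exact mul_le_mul_of_nonneg_left (norm_R_le_of_pair _ (hU μ z).1 (hU μ z).2 _) (abs_nonneg _)
    · rw [norm_ofReal_smul]
      refine mul_le_mul_of_nonneg_left (norm_R_le_of_pair _ ?_ ?_ _) (abs_nonneg _)
      · exact (hU μ ((shiftY i μ).symm z)).2
      · rw [inv_inv]; exact (hU μ ((shiftY i μ).symm z)).1
  · refine le_trans (norm_sum_le _ _) (Finset.sum_le_sum fun w _ => ?_)
    rw [norm_ofReal_smul, abs_mul]
    exact mul_le_mul_of_nonneg_left (norm_R_le_of_pair _ (hT w).1 (hT w).2 _) (mul_nonneg (abs_nonneg _) (abs_nonneg _))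

/-- ★ the same with ONE local bound `B` on `Λ` over the stencil of `z`:
`‖(K(h)(U)Λ)(z)‖ ≤ (Σ_μ (|h(z+e_μ) − h z| + |h(z−e_μ) − h z|) + Σ_w |avgCoeffY(z,w)|·|h z − h w|)·B`.
[cite: Balaban1985BackgroundPropagators, (3.88)–(3.89) p.409] -/
theorem norm_KhY_apply_le_of_bound (par : SiteParY 𝔸 i) (h : SiteY i → ℝ) (U : CfgY 𝔸 i) (Λ : SiteY i → 𝔸) (z : SiteY i)
    (hU : ∀ (μ : Fin (d + 1)) (w : SiteY i), ‖(UboxY i U μ w : 𝔸)‖ ≤ 1 ∧ ‖(((UboxY i U μ w)⁻¹ : 𝔸ˣ) : 𝔸)‖ ≤ 1)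
    (hT : ∀ w : SiteY i, ‖(avgTrY i par U z w : 𝔸)‖ ≤ 1 ∧ ‖(((avgTrY i par U z w)⁻¹ : 𝔸ˣ) : 𝔸)‖ ≤ 1)
    {B : ℝ} (hB : ∀ w ∈ stencilY i z, ‖Λ w‖ ≤ B) :
    ‖KhY i par h U Λ z‖
      ≤ ((∑ μ : Fin (d + 1), (|h (shiftY i μ z) - h z| + |h ((shiftY i μ).symm z) - h z|))
          + ∑ w, |avgCoeffY i z w| * |h z - h w|) * B := by
  have hB0 : 0 ≤ B := le_trans (norm_nonneg _) (hB z (self_mem_stencilY i z))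
  refine le_trans (norm_KhY_apply_le i par h U Λ z hU hT) ?_
  rw [add_mul, Finset.sum_mul, Finset.sum_mul]
  refine add_le_add (Finset.sum_le_sum fun μ _ => ?_) (Finset.sum_le_sum fun w _ => ?_)
  · rw [add_mul]
    exact add_le_add (mul_le_mul_of_nonneg_left (hB _ (shiftY_mem_stencilY i z μ)) (abs_nonneg _))
      (mul_le_mul_of_nonneg_left (hB _ (shiftY_symm_mem_stencilY i z μ)) (abs_nonneg _))
  · by_cases hw : avgCoeffY i z w = 0
    · rw [hw, abs_zero, zero_mul, zero_mul, zero_mul]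
    · exact mul_le_mul_of_nonneg_left (hB _ (mem_stencilY_of_avgCoeffY_ne_zero i z w hw))
        (mul_nonneg (abs_nonneg _) (abs_nonneg _))

end Generic

/-! ## §3 The differences of the partition of record `h_□` over the stencil -/

section Partition

variable {d ℓ : ℕ} {hd : 1 ≤ d + 1} {hL : Odd (ℓ + 1) ∧ 1 < ℓ + 1} {b₀ b₁ : ℝ}
variable (i : KIdx d ℓ hd hL b₀ b₁)

/-- the member's side conditions in the shape the gen-26 torus binders take them: `1 ≤ L−1`, `2 ≤ M_h`, `2L ≤ R`, `P′ ≥ 5`.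
[cite: Balaban1984PropagatorsII, (2.1)–(2.2) p.224, bookkeeping] -/
theorem side_conditions : 1 ≤ ℓ ∧ 2 ≤ i.Mh ∧ 2 * (ℓ + 1) ≤ i.R ∧ ∀ μ, 5 ≤ i.P' μ := by
  refine ⟨le_trans (by norm_num) i.hℓ, le_trans (by norm_num) i.hM8, le_trans ?_ i.hR2, i.hP5⟩
  have h1 : ℓ + 1 ≤ (ℓ + 1) ^ 2 := by nlinarith
  omega

/-- a unit lattice vector has sup norm `≤ 1` (and so has its negative). [cite: Balaban1984PropagatorsII, (2.45) p.231, bookkeeping] -/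
theorem supNorm_unitVec_le (μ : Fin (d + 1)) (s : ℤ) (hs : s = 1 ∨ s = -1) :
    B4ContourShift.supNorm (s • unitVec μ : Fin (d + 1) → ℤ) ≤ 1 := by
  refine B4Reflection242.supNorm_le_of_forall fun ν => ?_
  have h1 : |(s • unitVec μ : Fin (d + 1) → ℤ) ν| ≤ 1 := by
    rw [Pi.smul_apply, smul_eq_mul, unitVec]
    by_cases hν : ν = μ
    · subst hν; rw [Pi.single_eq_same, mul_one]; rcases hs with h | h <;> simp [h]
    · rw [Pi.single_eq_of_ne hν, mul_zero, abs_zero]; exact zero_le_one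
  exact_mod_cast h1

/-- **ONE TORUS STEP HAS TORUS LENGTH `≤ 1`**: `|z − σ_{s e_μ} z|_T ≤ 1` for `s = ±1`. [cite: Balaban1984PropagatorsII, (2.45)–(2.46) p.231, bookkeeping] -/
theorem torusSupNorm_sub_tshift_le_one {N : Fin (d + 1) → ℕ} (z : ↥(boxDom N)) (μ : Fin (d + 1)) (s : ℤ) (hs : s = 1 ∨ s = -1) :
    torusSupNorm N (z.1 - (tshift N (s • unitVec μ) z).1) ≤ 1 := by
  have hN : ∀ ν, 1 ≤ N ν := one_le_of_mem z.2
  obtain ⟨m, hm⟩ := tshift_val_eq_translate N (s • unitVec μ) z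
  have hmν : ∀ ν, (tshift N (s • unitVec μ) z).1 ν = (z.1 ν + (s • unitVec μ) ν) + (N ν : ℤ) * m ν := fun ν => by
    rw [hm]; rfl
  have e : z.1 - (tshift N (s • unitVec μ) z).1 = translate N (-(s • unitVec μ)) (-m) := by
    funext ν
    rw [Pi.sub_apply, hmν]
    show _ = (-(s • unitVec μ)) ν + (N ν : ℤ) * (-m) ν
    rw [Pi.neg_apply, Pi.neg_apply]
    ring
  rw [e, torusSupNorm_translate, torusSupNorm_neg hN]
  exact le_trans (torusSupNorm_le_supNorm hN _) (supNorm_unitVec_le μ s hs)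

/-- **ONE FORWARD LATTICE STEP COSTS `h_□` AT MOST `C1F∕(8∕5·S_j)`** (`S_j = M_h·L^{j+1}`; print's `|∂h_□| ≤ O(1)(MLʲη)⁻¹`), at the partition of record
read on def-Y's carrier. [cite: Balaban1984PropagatorsII, p.247 («|∂h_□| ≤ O(1)(MLʲη)⁻¹»); Balaban1985BackgroundPropagators, (3.89) p.409] -/
theorem abs_hTY_shiftY_sub_le (c : ↥(cubes i.D.toDomains)) (μ : Fin (d + 1)) (z : SiteY i) :
    |hTY i c (shiftY i μ z) - hTY i c z| ≤ C1F d ℓ / (8 / 5 * (bigSide ℓ i.Mh c.1.1 : ℝ)) := by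
  obtain ⟨hℓ, hMh, hR, hP5⟩ := side_conditions i
  have h1 : torusSupNorm (toKT i).NB (z.1 - (shiftY i μ z).1) ≤ 1 := by
    have e : shiftY i μ z = tshift (toKT i).NB ((1 : ℤ) • unitVec μ) z := by rw [one_smul]; rfl
    rw [e]; exact torusSupNorm_sub_tshift_le_one z μ 1 (Or.inl rfl)
  exact abs_hT_sub_le_near (D := i.D) hℓ hMh hR hP5 c h1

/-- the backward step likewise. [cite: Balaban1984PropagatorsII, p.247; Balaban1985BackgroundPropagators, (3.89) p.409] -/
theorem abs_hTY_shiftY_symm_sub_le (c : ↥(cubes i.D.toDomains)) (μ : Fin (d + 1)) (z : SiteY i) :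
    |hTY i c ((shiftY i μ).symm z) - hTY i c z| ≤ C1F d ℓ / (8 / 5 * (bigSide ℓ i.Mh c.1.1 : ℝ)) := by
  obtain ⟨hℓ, hMh, hR, hP5⟩ := side_conditions i
  have h1 : torusSupNorm (toKT i).NB (z.1 - ((shiftY i μ).symm z).1) ≤ 1 := by
    have e : (shiftY i μ).symm z = tshift (toKT i).NB ((-1 : ℤ) • unitVec μ) z := by
      rw [neg_one_smul]; exact tshift_symm_apply _ _ _
    rw [e]; exact torusSupNorm_sub_tshift_le_one z μ (-1) (Or.inr rfl)
  exact abs_hT_sub_le_near (D := i.D) hℓ hMh hR hP5 c h1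

/-- uniformly in the level: `C1F∕(8∕5·S_j) ≤ (5∕8)·C1F∕(L·M_h)` (`S_j = M_h·L^{j+1} ≥ L·M_h`). [cite: Balaban1984PropagatorsII, p.247, bookkeeping] -/
theorem C1F_div_bigSide_le (j : ℕ) :
    C1F d ℓ / (8 / 5 * (bigSide ℓ i.Mh j : ℝ)) ≤ 5 / 8 * C1F d ℓ / (((ℓ : ℝ) + 1) * i.Mh) := by
  obtain ⟨_, hMh, _, _⟩ := side_conditions i
  have hM : (0 : ℝ) < i.Mh := by exact_mod_cast (lt_of_lt_of_le (by norm_num) hMh)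
  have hL1 : (1 : ℝ) ≤ (ℓ : ℝ) + 1 := by linarith [(Nat.cast_nonneg ℓ : (0 : ℝ) ≤ ℓ)]
  have hS : ((ℓ : ℝ) + 1) * i.Mh ≤ (bigSide ℓ i.Mh j : ℝ) := by
    rw [bigSide_eq]
    push_cast
    have hpj : (1 : ℝ) ≤ ((ℓ : ℝ) + 1) ^ j := one_le_pow₀ hL1
    calc ((ℓ : ℝ) + 1) * i.Mh = 1 * ((i.Mh : ℝ) * ((ℓ : ℝ) + 1)) := by ring
      _ ≤ ((ℓ : ℝ) + 1) ^ j * ((i.Mh : ℝ) * ((ℓ : ℝ) + 1)) := mul_le_mul_of_nonneg_right hpj (by positivity)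
  have hLM : (0 : ℝ) < ((ℓ : ℝ) + 1) * i.Mh := mul_pos (by positivity) hM
  have hS0 : (0 : ℝ) < 8 / 5 * (bigSide ℓ i.Mh j : ℝ) := by linarith
  rw [div_le_div_iff₀ hS0 hLM]
  have hC := C1F_nonneg d ℓ
  nlinarith [mul_le_mul_of_nonneg_left hS hC]

/-- **INSIDE ONE AVERAGING BLOCK `h_□` MOVES BY AT MOST `sLipT∕(L·M_h)`**: if `avgCoeffY(z,w) ≠ 0` then `w` lies in the `L^{lev z}`-block of `z`, the two
sites have the same block of `𝔅`, and the torus Lipschitz binder gives `|h_□(z) − h_□(w)| ≤ sLipT∕(L·M_h)·(0 + 1)`.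
[cite: Balaban1984PropagatorsII, p.247 («h_□′(x′) − h_□′(x) can be estimated by O(1)M⁻¹d(y,y′)»); Balaban1985BackgroundPropagators, (3.88) p.409 (second line)] -/
theorem abs_hTY_sub_le_of_avgCoeffY_ne_zero (c : ↥(cubes i.D.toDomains)) {z w : SiteY i} (hw : avgCoeffY i z w ≠ 0) :
    |hTY i c z - hTY i c w| ≤ sLipT d ℓ / (((ℓ : ℝ) + 1) * i.Mh) := by
  obtain ⟨hℓ, hMh, hR, hP5⟩ := side_conditions i
  have hblk : blk ((ℓ + 1) ^ levY i z) w.1 = blk ((ℓ + 1) ^ levY i z) z.1 := by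
    by_contra hne
    exact hw (by rw [avgCoeffY, B4Reflection242.avgK, if_neg hne])
  have hbo : blkOf i.D.toDomains w = blkOf i.D.toDomains z :=
    blkOf_eq_of_blk_i_eq (D := i.D.toDomains) (x := z) (x' := w) (i := levY i z) le_rfl hblk
  have h := abs_hT_sub_le_distT (D := i.D) hℓ hMh hR hP5 c w z
  rw [hbo, SimpleGraph.dist_self, Nat.cast_zero, zero_add, mul_one] at h
  exact h

/-- the averaging coefficient is non-negative. [cite: Balaban1984PropagatorsII, (2.14) p.225, bookkeeping] -/
theorem avgCoeffY_nonneg (z w : SiteY i) : 0 ≤ avgCoeffY i z w := by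
  unfold avgCoeffY B4Reflection242.avgK
  split_ifs
  · unfold levC aPrinted
    have hℓ : 1 ≤ ℓ := (side_conditions i).1
    have hL : (1 : ℝ) < (ℓ : ℝ) + 1 := by
      have : (1 : ℝ) ≤ ℓ := by exact_mod_cast hℓ
      linarith
    have ha := B1.aSeq_pos (a := (1 : ℝ)) one_pos hL ((toKT i).D.one_le_lev z.1)
    positivity
  · exact le_rfl

/-- **THE TOTAL AVERAGING WEIGHT AT A SITE**: `Σ_w avgCoeffY(z,w) = a_{lev z}·L^{−2·lev z}` (the `L^{lev z}`-block of `z` has `L^{(d+1)·lev z}` sites, all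
inside the box) — hence `≤ 1` (`a_j ≤ a₁ = 1`). [cite: Balaban1984PropagatorsII, (2.13)–(2.14) p.225 («a_j(Lʲη)^{−2} Σ L^{−jd}»)] -/
theorem sum_abs_avgCoeffY_le_one (z : SiteY i) : ∑ w, |avgCoeffY i z w| ≤ 1 := by
  classical
  obtain ⟨hℓ, hMh, _, _⟩ := side_conditions i
  set n : ℕ := (ℓ + 1) ^ levY i z with hn
  have hn1 : 1 ≤ n := Nat.one_le_pow _ _ (Nat.succ_pos ℓ)
  -- every term is `levC` on the block of `z` and `0` elsewhere
  have hterm : ∀ w : SiteY i, |avgCoeffY i z w|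
      = if blk n w.1 = blk n z.1 then levC d ℓ (aPrinted ℓ 1) (levY i z) else 0 := fun w => by
    rw [abs_of_nonneg (avgCoeffY_nonneg i z w)]
    rfl
  simp_rw [hterm]
  rw [Finset.sum_ite, Finset.sum_const_zero, add_zero, Finset.sum_const, nsmul_eq_mul]
  -- the block fibre inside the box injects into the block of `z` in `ℤ^{d+1}`, of cardinality `n^{d+1}`
  have hcard : ((Finset.univ.filter fun w : SiteY i => blk n w.1 = blk n z.1).card : ℝ) ≤ ((n : ℝ)) ^ (d + 1) := by
    have h1 : (Finset.univ.filter fun w : SiteY i => blk n w.1 = blk n z.1).card ≤ (B4Reflection242.blockOf n z.1).card := by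
      refine Finset.card_le_card_of_injOn (fun w : SiteY i => (w.1 : Fin (d + 1) → ℤ)) (fun w hw => ?_) ?_
      · rw [Finset.mem_coe, Finset.mem_filter] at hw
        exact (B4Reflection242.mem_blockOf hn1).2 hw.2
      · intro w _ w' _ hww'
        exact Subtype.ext hww'
    have h2 : (B4Reflection242.blockOf n z.1).card = n ^ (d + 1) := by
      unfold B4Reflection242.blockOf
      rw [Fintype.card_piFinset]
      simp only [Int.card_Ico, add_sub_cancel_left, Int.toNat_natCast, Finset.prod_const, Finset.card_univ, Fintype.card_fin]
    exact_mod_cast (h1.trans h2.le)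
  -- `levC · n^{d+1} = a_{lev z} · L^{−2 lev z} ≤ 1`
  have hL : (1 : ℝ) < (ℓ : ℝ) + 1 := by
    have : (1 : ℝ) ≤ ℓ := by exact_mod_cast hℓ
    linarith
  have hj : 1 ≤ levY i z := (toKT i).D.one_le_lev z.1
  have ha1 : aPrinted ℓ 1 (levY i z) ≤ 1 := B1.aSeq_le (a := (1 : ℝ)) one_pos hL _ hj
  have ha0 : 0 < aPrinted ℓ 1 (levY i z) := B1.aSeq_pos (a := (1 : ℝ)) one_pos hL hj
  have hnR : (n : ℝ) = ((ℓ : ℝ) + 1) ^ levY i z := by rw [hn]; push_cast; ring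
  have hnpos : (0 : ℝ) < (n : ℝ) := by exact_mod_cast hn1
  have hlevC : 0 ≤ levC d ℓ (aPrinted ℓ 1) (levY i z) := by unfold levC; positivity
  calc ((Finset.univ.filter fun w : SiteY i => blk n w.1 = blk n z.1).card : ℝ) * levC d ℓ (aPrinted ℓ 1) (levY i z)
      ≤ (n : ℝ) ^ (d + 1) * levC d ℓ (aPrinted ℓ 1) (levY i z) := mul_le_mul_of_nonneg_right hcard hlevC
    _ = aPrinted ℓ 1 (levY i z) * (((n : ℝ)) ^ 2)⁻¹ := by
        unfold levC
        rw [← hnR]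
        field_simp
    _ ≤ 1 * 1 := by
        refine mul_le_mul ha1 ?_ (by positivity) zero_le_one
        have h1n : (1 : ℝ) ≤ (n : ℝ) ^ 2 := one_le_pow₀ (by exact_mod_cast hn1)
        exact inv_le_one_of_one_le₀ h1n
    _ = 1 := one_mul _

end Partition

/-! ## §4 The `O(M⁻¹)` of (3.89) before `G′_□` enters -/

section Size

variable {d ℓ : ℕ} {hd : 1 ≤ d + 1} {hL : Odd (ℓ + 1) ∧ 1 < ℓ + 1} {b₀ b₁ : ℝ}
variable (i : KIdx d ℓ hd hL b₀ b₁)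

/-- **THE CONSTANT OF THE `G′`-FREE HALF OF (3.89)**: `θ_K(d, L) := 2(d+1)·(5∕8)·C1F + sLipT` (the `2(d+1)` lattice steps of the first line of (3.88)
and the one averaging block of the second), depending on `d` and `L = ℓ + 1` only. [cite: Balaban1985BackgroundPropagators, (3.89) p.409 («O(M⁻¹)»)] -/
def thetaK (d ℓ : ℕ) : ℝ := 2 * ((d : ℝ) + 1) * (5 / 8 * C1F d ℓ) + sLipT d ℓ

/-- `θ_K ≥ 0`. [cite: Balaban1985BackgroundPropagators, (3.89) p.409, bookkeeping] -/
theorem thetaK_nonneg (d ℓ : ℕ) : 0 ≤ thetaK d ℓ := by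
  unfold thetaK
  have := C1F_nonneg d ℓ
  have := sLipT_nonneg d ℓ
  positivity

/-- the coefficient sum of `K(h_□)` at a site is `≤ θ_K∕(L·M_h)`. [cite: Balaban1985BackgroundPropagators, (3.89) p.409; Balaban1984PropagatorsII, p.247] -/
theorem coeffSum_hTY_le (c : ↥(cubes i.D.toDomains)) (z : SiteY i) :
    (∑ μ : Fin (d + 1), (|hTY i c (shiftY i μ z) - hTY i c z| + |hTY i c ((shiftY i μ).symm z) - hTY i c z|))
        + ∑ w, |avgCoeffY i z w| * |hTY i c z - hTY i c w|
      ≤ thetaK d ℓ / (((ℓ : ℝ) + 1) * i.Mh) := by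
  have hstep : ∀ μ : Fin (d + 1),
      |hTY i c (shiftY i μ z) - hTY i c z| + |hTY i c ((shiftY i μ).symm z) - hTY i c z|
        ≤ 2 * (5 / 8 * C1F d ℓ / (((ℓ : ℝ) + 1) * i.Mh)) := fun μ => by
    have h1 := (abs_hTY_shiftY_sub_le i c μ z).trans (C1F_div_bigSide_le i c.1.1)
    have h2 := (abs_hTY_shiftY_symm_sub_le i c μ z).trans (C1F_div_bigSide_le i c.1.1)
    linarith
  have hA : (∑ μ : Fin (d + 1), (|hTY i c (shiftY i μ z) - hTY i c z| + |hTY i c ((shiftY i μ).symm z) - hTY i c z|))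
      ≤ 2 * ((d : ℝ) + 1) * (5 / 8 * C1F d ℓ) / (((ℓ : ℝ) + 1) * i.Mh) := by
    refine (Finset.sum_le_sum fun μ _ => hstep μ).trans ?_
    rw [Finset.sum_const, Finset.card_univ, Fintype.card_fin, nsmul_eq_mul]
    push_cast
    exact le_of_eq (by ring)
  have hB : ∑ w, |avgCoeffY i z w| * |hTY i c z - hTY i c w| ≤ sLipT d ℓ / (((ℓ : ℝ) + 1) * i.Mh) := by
    have h1 : ∀ w, |avgCoeffY i z w| * |hTY i c z - hTY i c w| ≤ |avgCoeffY i z w| * (sLipT d ℓ / (((ℓ : ℝ) + 1) * i.Mh)) := by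
      intro w
      by_cases hw : avgCoeffY i z w = 0
      · rw [hw, abs_zero, zero_mul, zero_mul]
      · exact mul_le_mul_of_nonneg_left (abs_hTY_sub_le_of_avgCoeffY_ne_zero i c hw) (abs_nonneg _)
    refine (Finset.sum_le_sum fun w _ => h1 w).trans ?_
    rw [← Finset.sum_mul]
    have hK : 0 ≤ sLipT d ℓ / (((ℓ : ℝ) + 1) * i.Mh) := div_nonneg (sLipT_nonneg d ℓ) (by positivity)
    calc (∑ w, |avgCoeffY i z w|) * (sLipT d ℓ / (((ℓ : ℝ) + 1) * i.Mh))
        ≤ 1 * (sLipT d ℓ / (((ℓ : ℝ) + 1) * i.Mh)) := mul_le_mul_of_nonneg_right (sum_abs_avgCoeffY_le_one i z) hK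
      _ = _ := one_mul _
  calc _ ≤ 2 * ((d : ℝ) + 1) * (5 / 8 * C1F d ℓ) / (((ℓ : ℝ) + 1) * i.Mh) + sLipT d ℓ / (((ℓ : ℝ) + 1) * i.Mh) := add_le_add hA hB
    _ = thetaK d ℓ / (((ℓ : ℝ) + 1) * i.Mh) := by unfold thetaK; rw [add_div]

/-- ★★ **THE `O(M⁻¹)` OF (3.89) BEFORE `G′_□` ENTERS**: at the partition of record and contraction-pair transporters, for every `Λ` bounded by `B` on the
stencil of `z`, `‖(K(h_□)(U)Λ)(z)‖ ≤ θ_K(d,L)∕(L·M_h) · B` — print's «O(M⁻¹)» with `M = L·M_h` and `θ_K` explicit; (3.89) itself is this with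
`Λ := G′_□h_□λ` and (3.42) for `G′_□` supplying `B` (module M5.4-est). [cite: Balaban1985BackgroundPropagators, (3.89) p.409; Balaban1984PropagatorsII, (2.44) p.230] -/
theorem norm_KhY_hTY_apply_le (par : SiteParY 𝔸 i) (c : ↥(cubes i.D.toDomains)) (U : CfgY 𝔸 i) (Λ : SiteY i → 𝔸) (z : SiteY i)
    (hU : ∀ (μ : Fin (d + 1)) (w : SiteY i), ‖(UboxY i U μ w : 𝔸)‖ ≤ 1 ∧ ‖(((UboxY i U μ w)⁻¹ : 𝔸ˣ) : 𝔸)‖ ≤ 1)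
    (hT : ∀ w : SiteY i, ‖(avgTrY i par U z w : 𝔸)‖ ≤ 1 ∧ ‖(((avgTrY i par U z w)⁻¹ : 𝔸ˣ) : 𝔸)‖ ≤ 1)
    {B : ℝ} (hB : ∀ w ∈ stencilY i z, ‖Λ w‖ ≤ B) :
    ‖KhY i par (hTY i c) U Λ z‖ ≤ thetaK d ℓ / (((ℓ : ℝ) + 1) * i.Mh) * B := by
  have hB0 : 0 ≤ B := le_trans (norm_nonneg _) (hB z (self_mem_stencilY i z))
  exact (norm_KhY_apply_le_of_bound i par (hTY i c) U Λ z hU hT hB).trans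
    (mul_le_mul_of_nonneg_right (coeffSum_hTY_le i c z) hB0)

end Size

/-! ## §5 Output localisation of `K(h_□)(U)` -/

section Localisation

variable {d ℓ : ℕ} {hd : 1 ≤ d + 1} {hL : Odd (ℓ + 1) ∧ 1 < ℓ + 1} {b₀ b₁ : ℝ}
variable (i : KIdx d ℓ hd hL b₀ b₁)

/-- where `(K(h)(U)Λ)(z) ≠ 0`, the cut-off is NOT constant on the stencil of `z`. [cite: Balaban1985BackgroundPropagators, (3.88) p.409, p.410 («semi-local»)] -/
theorem exists_mem_stencilY_ne_of_KhY_ne_zero (par : SiteParY 𝔸 i) (h : SiteY i → ℝ) (U : CfgY 𝔸 i) (Λ : SiteY i → 𝔸) (z : SiteY i)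
    (hz : KhY i par h U Λ z ≠ 0) : ∃ w ∈ stencilY i z, h w ≠ h z := by
  by_contra hc
  push Not at hc
  exact hz (KhY_apply_eq_zero_of_const i par h U Λ z hc)

/-- `P′_μ ≥ 4` in the shape of `QT`'s argument (`1 ≤ M_h` is n06's `B9GeoLemma21KLevelV1.one_le_Mh`). [cite: Balaban1984PropagatorsII, (2.1) p.224, bookkeeping] -/
theorem four_le_P' : ∀ μ, 4 ≤ i.P' μ := fun μ => le_trans (by norm_num) (i.hP5 μ)

/-- ★ **OUTPUT LOCALISATION OF `K(h_□)(U)`**: where `(K(h_□)(U)Λ)(z) ≠ 0`, some site of the stencil of `z` carries `h_□ ≠ 0`, hence has its block of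
`𝔅` in `QT □ ⊂ □̃` (this seat's gen-26 `blkOf_mem_QT_of_hT_ne_zero`) — the localisation set `S′_□` of the (3.89) terms is the one-stencil thickening
of `QT □`. [cite: Balaban1985BackgroundPropagators, (3.89) p.409 («y, y′ ∈ □ ∈ 𝒟_j»), (3.91) p.410] -/
theorem exists_mem_stencilY_blkOf_mem_QT_of_KhY_ne_zero (par : SiteParY 𝔸 i) (c : ↥(cubes i.D.toDomains)) (U : CfgY 𝔸 i)
    (Λ : SiteY i → 𝔸) (z : SiteY i) (hz : KhY i par (hTY i c) U Λ z ≠ 0) :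
    ∃ w ∈ stencilY i z, blkOf i.D.toDomains w ∈ QT i.D (B9GeoLemma21KLevelV1.one_le_Mh i) (four_le_P' i) c := by
  obtain ⟨hℓ, hMh, hR, hP5⟩ := side_conditions i
  obtain ⟨w, hw, hne⟩ := exists_mem_stencilY_ne_of_KhY_ne_zero i par (hTY i c) U Λ z hz
  by_cases h0 : hTY i c w = 0
  · rw [h0] at hne
    exact ⟨z, self_mem_stencilY i z,
      B6Partition118KLevelTorusCentral.blkOf_mem_QT_of_hT_ne_zero (D := i.D) hMh hR (four_le_P' i) c (Ne.symm hne)⟩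
  · exact ⟨w, hw, B6Partition118KLevelTorusCentral.blkOf_mem_QT_of_hT_ne_zero (D := i.D) hMh hR (four_le_P' i) c h0⟩

end Localisation

end Literature.MathematicalPhysics.QuantumFieldTheory.Balaban1983to89.B9Thm37CubeCoverCommutatorSizes

end
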